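import Mathlib
import Summits.Ventures.PercRepro2.HCov
import Summits.Ventures.PercRepro2.BHKOutside
import Summits.Ventures.PercRepro2.RootLeafUPocketFacts
import Summits.Ventures.PercRepro2.RootLeafUPocketAtoms
import Summits.Ventures.PercRepro2.RootLeafUPocketC44
import Summits.Ventures.PercRepro2.RootLeafUPocketHarrisOutCells

/-!
# HARRIS-OUT for the pocket copy: the two outside events `{c ~ a₂}` and `{b ~ {a₂, c}}` are positively
correlated given that the pocket cluster of `u` avoids `{a₂, c}` (blind cell PercRepro2, p4 g21;
S3 (G4-u), proofs/P4-G21-HARRISOUT.md §3; generated text, no definitions)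

The fact behind the two o-pocket coefficients of (XB-PD) that had no certificate over the level-1 / level-2
slack menus (S3 v81).  With `K = C_P(a₂)`, `L = C_P(u)` the pocket clusters and, on `{u ↮_P a₂}`,
`A = P(c ∈ K, b ∈ K)`, `PoK = P(c ∈ K)`, `PoN = P(c ∉ K ∪ L)`, `G = P(c ∉ K ∪ L, b ∈ K)`,
`C = P(c ∉ K ∪ L, c ~ b)`:

  `PoK · (A + G + C) ≤ A · P(c ∉ L)`, i.e. `A · PoN ≥ PoK · (G + C)`   ((1g) of the paper; `factH_tg`),

the tree's `bhk_two_outside_avoid` (BHKOutside.lean: BHK06 Thm 1.3 for the explored cluster of `u` with two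
outside events) transported to the pocket copy `inn` by `prob_inn_eq` (`bhk_two_outside_inn`), with `s := u`,
`X := {a₂, c}`, the outside events `c ∈ C(a₂)` and `C(b) ∋ a₂ ∨ c` (`harrisOut_events_eq`), and the four masses
written as sums of the fifteen atoms of the pocket copy through `PocketAtoms.atoms_cover` (the cells lemmas
`cellsH_k` of RootLeafUPocketHarrisOutCells).  Generic in the four vertex names `(u, a₂, c, b)`; the o-pocket instance is `c := o`.
-/

namespace Summit.Ventures.PercRepro2

open UnionCluster CovForm

namespace RootLeafU

namespace PocketFacts

variable {V : Type*} {E : Type*} [Fintype E] [DecidableEq E] [Fintype V] [DecidableEq V]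
  {R : Type*} [Field R] [LinearOrder R] [IsStrictOrderedRing R] (p : E → R)
variable {ends : E → Sym2 V} {P : Set V} {inn : Config E → Config E}

variable (hp : IsProbVec p)
  (hinn : (∀ ω e, e ∈ touches ends P → inn ω e = ω e) ∧ (∀ ω e, e ∉ touches ends P → inn ω e = false))
include hp hinn

/-- BHK06 Thm 1.3 for the explored pocket cluster of `s` with two OUTSIDE events (`bhk_two_outside_avoid`),
transported to the pocket copy: for up-sets `𝓤, 𝓥` and vertices `u, v`,
`P(C_u ∈ 𝓤, s ↮ X ∪ {u}) · P(C_v ∈ 𝓥, s ↮ X ∪ {v}) ≤ P(C_u ∈ 𝓤, C_v ∈ 𝓥, s ↮ X ∪ {u, v}) · P(s ↮ X)`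
for the pocket clusters. -/
theorem bhk_two_outside_inn (s u v : V) (X : Finset V) {𝓤 𝓥 : Set (Set V)} (h𝓤 : IsUpperSet 𝓤)
    (h𝓥 : IsUpperSet 𝓥) :
    prob p {ω : Config E | inn ω ∈ clusterInEvent ends u 𝓤 ∩ avoidAll ends s (insert u X)} *
        prob p {ω : Config E | inn ω ∈ clusterInEvent ends v 𝓥 ∩ avoidAll ends s (insert v X)} ≤
      prob p {ω : Config E | inn ω ∈ clusterInEvent ends u 𝓤 ∩ clusterInEvent ends v 𝓥 ∩
          avoidAll ends s (insert u (insert v X))} *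
        prob p {ω : Config E | inn ω ∈ avoidAll ends s X} := by
  classical
  rw [prob_inn_eq p hinn, prob_inn_eq p hinn, prob_inn_eq p hinn, prob_inn_eq p hinn]
  exact bhk_two_outside_avoid _ (PocketConn.IsProbVec.zeroOn hp _) ends s u v X h𝓤 h𝓥

end PocketFacts

namespace PocketBridge

variable {V : Type*} {E : Type*}
variable {ends : E → Sym2 V} {P : Set V} {u a₂ c b : V} {inn : Config E → Config E}

section Events

variable [DecidableEq V]

/-- The four events of HARRIS-OUT (`bhk_two_outside_inn` with `s := u`, `X := {a₂, c}`, the outside events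
`c ∈ C(a₂)` and `C(b) ∋ a₂ ∨ c`) as literal conjunctions of connections of the pocket copy. -/
theorem harrisOut_events_eq :
    ({ω : Config E | inn ω ∈ clusterInEvent ends a₂ {S : Set V | c ∈ S} ∩
        avoidAll ends u (insert a₂ ({a₂, c} : Finset V))} = {ω : Config E | inn ω ∈ {ω' : Config E | ¬ Conn ends ω' u a₂ ∧ ¬ Conn ends ω' u c ∧ Conn ends ω' a₂ c}}) ∧
    ({ω : Config E | inn ω ∈ clusterInEvent ends b {S : Set V | a₂ ∈ S ∨ c ∈ S} ∩
        avoidAll ends u (insert b ({a₂, c} : Finset V))} = {ω : Config E | inn ω ∈ {ω' : Config E | ¬ Conn ends ω' u a₂ ∧ ¬ Conn ends ω' u c ∧ ¬ Conn ends ω' u b ∧ Conn ends ω' a₂ b}} ∪ {ω : Config E | inn ω ∈ {ω' : Config E | ¬ Conn ends ω' u a₂ ∧ ¬ Conn ends ω' u c ∧ ¬ Conn ends ω' u b ∧ ¬ Conn ends ω' a₂ b ∧ Conn ends ω' c b}}) ∧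
    ({ω : Config E | inn ω ∈ clusterInEvent ends a₂ {S : Set V | c ∈ S} ∩
        clusterInEvent ends b {S : Set V | a₂ ∈ S ∨ c ∈ S} ∩
        avoidAll ends u (insert a₂ (insert b ({a₂, c} : Finset V)))} = {ω : Config E | inn ω ∈ {ω' : Config E | ¬ Conn ends ω' u a₂ ∧ ¬ Conn ends ω' u c ∧ ¬ Conn ends ω' u b ∧ Conn ends ω' a₂ c ∧ Conn ends ω' a₂ b}}) ∧
    ({ω : Config E | inn ω ∈ avoidAll ends u ({a₂, c} : Finset V)} = {ω : Config E | inn ω ∈ {ω' : Config E | ¬ Conn ends ω' u a₂ ∧ ¬ Conn ends ω' u c}}) := by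
  classical
  refine ⟨?_, ?_, ?_, ?_⟩
  · ext ω
    constructor
    · intro h
      exact ⟨h.2 a₂ (Finset.mem_insert_self a₂ _), h.2 c (Finset.mem_insert_of_mem (Finset.mem_insert_of_mem (Finset.mem_singleton_self c))), h.1⟩
    · intro h
      refine ⟨h.2.2, fun x hx => ?_⟩
      rcases Finset.mem_insert.1 hx with rfl | hx
      · exact h.1
      rcases Finset.mem_insert.1 hx with rfl | hx
      · exact h.1
      rw [Finset.mem_singleton] at hx
      subst hx
      exact h.2.1
  · ext ω
    constructor
    · intro h
      have hub : ¬ Conn ends (inn ω) u b := h.2 b (Finset.mem_insert_self b _)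
      have hua : ¬ Conn ends (inn ω) u a₂ := h.2 a₂ (Finset.mem_insert_of_mem (Finset.mem_insert_self a₂ _))
      have huc : ¬ Conn ends (inn ω) u c := h.2 c (Finset.mem_insert_of_mem (Finset.mem_insert_of_mem (Finset.mem_singleton_self c)))
      rcases (h.1 : Conn ends (inn ω) b a₂ ∨ Conn ends (inn ω) b c) with hba | hbc
      · exact Or.inl ⟨hua, huc, hub, conn_symm hba⟩
      · by_cases hab : Conn ends (inn ω) a₂ b
        · exact Or.inl ⟨hua, huc, hub, hab⟩
        · exact Or.inr ⟨hua, huc, hub, hab, conn_symm hbc⟩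
    · intro h
      have hav : ∀ x ∈ insert b ({a₂, c} : Finset V), ¬ Conn ends (inn ω) u x := by
        intro x hx
        rcases Finset.mem_insert.1 hx with rfl | hx
        · exact h.elim (fun h => h.2.2.1) (fun h => h.2.2.1)
        rcases Finset.mem_insert.1 hx with rfl | hx
        · exact h.elim (fun h => h.1) (fun h => h.1)
        rw [Finset.mem_singleton] at hx
        subst hx
        exact h.elim (fun h => h.2.1) (fun h => h.2.1)
      rcases h with h | h
      · exact ⟨Or.inl (conn_symm h.2.2.2), hav⟩
      · exact ⟨Or.inr (conn_symm h.2.2.2.2), hav⟩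
  · ext ω
    constructor
    · intro h
      have hua : ¬ Conn ends (inn ω) u a₂ := h.2 a₂ (Finset.mem_insert_self a₂ _)
      have hub : ¬ Conn ends (inn ω) u b := h.2 b (Finset.mem_insert_of_mem (Finset.mem_insert_self b _))
      have huc : ¬ Conn ends (inn ω) u c := h.2 c (Finset.mem_insert_of_mem (Finset.mem_insert_of_mem (Finset.mem_insert_of_mem (Finset.mem_singleton_self c))))
      have hac : Conn ends (inn ω) a₂ c := h.1.1
      refine ⟨hua, huc, hub, hac, ?_⟩
      rcases (h.1.2 : Conn ends (inn ω) b a₂ ∨ Conn ends (inn ω) b c) with hba | hbc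
      · exact conn_symm hba
      · exact conn_trans hac (conn_symm hbc)
    · intro h
      refine ⟨⟨h.2.2.2.1, Or.inl (conn_symm h.2.2.2.2)⟩, fun x hx => ?_⟩
      rcases Finset.mem_insert.1 hx with rfl | hx
      · exact h.1
      rcases Finset.mem_insert.1 hx with rfl | hx
      · exact h.2.2.1
      rcases Finset.mem_insert.1 hx with rfl | hx
      · exact h.1
      rw [Finset.mem_singleton] at hx
      subst hx
      exact h.2.1
  · ext ω
    constructor
    · intro h
      exact ⟨h a₂ (Finset.mem_insert_self a₂ _), h c (Finset.mem_insert_of_mem (Finset.mem_singleton_self c))⟩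
    · intro h x hx
      rcases Finset.mem_insert.1 hx with rfl | hx
      · exact h.1
      rw [Finset.mem_singleton] at hx
      subst hx
      exact h.2

end Events

section Fact

variable [Fintype E] [DecidableEq E] [Fintype V] [DecidableEq V] {R : Type*} [Field R] [LinearOrder R]
  [IsStrictOrderedRing R] (p : E → R)

/-- **HARRIS-OUT for the pocket copy** ((1g) of P4-G21-HARRISOUT.md): `A · PoN − PoK · (G + C) ≥ 0` at the atom probabilities of `inn` — the slack `TG` of the two o-pocket certificates. -/
theorem factH_tg (hp : IsProbVec p)
    (hinn : (∀ ω e, e ∈ touches ends P → inn ω e = ω e) ∧ (∀ ω e, e ∉ touches ends P → inn ω e = false)) :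
    0 ≤ 1*(prob p {ω : Config E | inn ω ∈ {ω' : Config E | ¬ Conn ends ω' u a₂ ∧ ¬ Conn ends ω' u c ∧ Conn ends ω' u b ∧ ¬ Conn ends ω' a₂ c ∧ ¬ Conn ends ω' a₂ b ∧ ¬ Conn ends ω' c b}})*(prob p {ω : Config E | inn ω ∈ {ω' : Config E | ¬ Conn ends ω' u a₂ ∧ ¬ Conn ends ω' u c ∧ ¬ Conn ends ω' u b ∧ Conn ends ω' a₂ c ∧ Conn ends ω' a₂ b ∧ Conn ends ω' c b}}) + (-1)*(prob p {ω : Config E | inn ω ∈ {ω' : Config E | ¬ Conn ends ω' u a₂ ∧ ¬ Conn ends ω' u c ∧ ¬ Conn ends ω' u b ∧ Conn ends ω' a₂ c ∧ ¬ Conn ends ω' a₂ b ∧ ¬ Conn ends ω' c b}})*(prob p {ω : Config E | inn ω ∈ {ω' : Config E | ¬ Conn ends ω' u a₂ ∧ ¬ Conn ends ω' u c ∧ ¬ Conn ends ω' u b ∧ ¬ Conn ends ω' a₂ c ∧ Conn ends ω' a₂ b ∧ ¬ Conn ends ω' c b}}) + (-1)*(prob p {ω : Config E | inn ω ∈ {ω'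 : Config E | ¬ Conn ends ω' u a₂ ∧ ¬ Conn ends ω' u c ∧ ¬ Conn ends ω' u b ∧ Conn ends ω' a₂ c ∧ ¬ Conn ends ω' a₂ b ∧ ¬ Conn ends ω' c b}})*(prob p {ω : Config E | inn ω ∈ {ω' : Config E | ¬ Conn ends ω' u a₂ ∧ ¬ Conn ends ω' u c ∧ ¬ Conn ends ω' u b ∧ ¬ Conn ends ω' a₂ c ∧ ¬ Conn ends ω' a₂ b ∧ Conn ends ω' c b}}) + (-1)*(prob p {ω : Config E | inn ω ∈ {ω' : Config E | ¬ Conn ends ω' u a₂ ∧ ¬ Conn ends ω' u c ∧ ¬ Conn ends ω' u b ∧ ¬ Conn ends ω' a₂ c ∧ Conn ends ω' a₂ b ∧ ¬ Conn ends ω' c b}})*(prob p {ω : Config E | inn ω ∈ {ω' : Config E | ¬ Conn ends ω' u a₂ ∧ ¬ Conn ends ω' u c ∧ Conn ends ω' u b ∧ Conn ends ω' a₂ c ∧ ¬ Conn ends ω' a₂ b ∧ ¬ Conn ends ω' c b}}) + 1*(prob p {ω : Config E | inn ω ∈ {ω' : Config E | ¬ Conn ends ω' u a₂ ∧ ¬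 Conn ends ω' u c ∧ ¬ Conn ends ω' u b ∧ ¬ Conn ends ω' a₂ c ∧ ¬ Conn ends ω' a₂ b ∧ ¬ Conn ends ω' c b}})*(prob p {ω : Config E | inn ω ∈ {ω' : Config E | ¬ Conn ends ω' u a₂ ∧ ¬ Conn ends ω' u c ∧ ¬ Conn ends ω' u b ∧ Conn ends ω' a₂ c ∧ Conn ends ω' a₂ b ∧ Conn ends ω' c b}}) + (-1)*(prob p {ω : Config E | inn ω ∈ {ω' : Config E | ¬ Conn ends ω' u a₂ ∧ ¬ Conn ends ω' u c ∧ ¬ Conn ends ω' u b ∧ ¬ Conn ends ω' a₂ c ∧ ¬ Conn ends ω' a₂ b ∧ Conn ends ω' c b}})*(prob p {ω : Config E | inn ω ∈ {ω' : Config E | ¬ Conn ends ω' u a₂ ∧ ¬ Conn ends ω' u c ∧ Conn ends ω' u b ∧ Conn ends ω' a₂ c ∧ ¬ Conn ends ω' a₂ b ∧ ¬ Conn ends ω' c b}}) := by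
  have h := PocketFacts.bhk_two_outside_inn p hp hinn u a₂ b ({a₂, c} : Finset V) (𝓤 := {S : Set V | c ∈ S})
    (𝓥 := {S : Set V | a₂ ∈ S ∨ c ∈ S}) (fun _ _ hST hS => hST hS)
    (fun _ _ hST hS => hS.elim (fun h1 => Or.inl (hST h1)) (fun h2 => Or.inr (hST h2)))
  obtain ⟨e1, e2, e3, e4⟩ := harrisOut_events_eq (ends := ends) (u := u) (a₂ := a₂) (c := c) (b := b) (inn := inn)
  rw [e1, e2, e3, e4] at h
  rw [prob_union_of_disjoint p (by
    rw [Set.disjoint_left]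
    intro ω h1 h2
    simp only [Set.mem_setOf_eq] at h1 h2
    exact absurd h1.2.2.2 h2.2.2.2.1)] at h
  rw [cellsH_1, cellsH_2a, cellsH_2b, cellsH_3, cellsH_4] at h
  linear_combination h

end Fact

end PocketBridge

end RootLeafU

end Summit.Ventures.PercRepro2
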